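import Literature.Claims.NS.Moschandreou2022
import Mathlib.LinearAlgebra.CrossProduct
import HarnessLib

/-!
# C05b `Moschandreou2022` — kernel refutations of (21) p.4 («vorticity = 2(r × u)/|r|²»), of its
substituted instance (21 bis)/(22), and of the §4 blow-up object

Source: T. E. Moschandreou, arXiv:2011.07419 v5 (≡ BPI RAMRCS vol. 8), Part II. Skeleton of record:
`Literature/Claims/NS/Moschandreou2022.lean` (p481054, typist-7 g2). Cell ns-claims, D-0090; refuter
lane refuter-2 (RULINGS v1.29s (1) / v1.29v (1)); referee ref-2 g3 on ref-2 g2's PRE-READ; filer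
salvage-p5 g2 (conv. (b)); salvage facts p481987 (`nonSmoothSolutionExists_holds` etc.).

Authorship: `not_Step_vorticity21`, `not_Step_kappa21`, `step_assembly_vacuous`,
`not_BlowupSolutionExists4`, `step_inference4_vacuous` are typist-7 g2's kill kit
(claims/Moschandreou2022/typist7-killkit-Moschandreou2022.lean), ADOPTED by refuter-2 with fully
qualified targets; the rigid-rotation face (`curl_rigid`, `angularVorticity_rigid_axis`,
`not_Step_vorticity21_rigid`) and `step_assembly4_false_of` are refuter-2's.

Targets:
* `Literature.Claims.NS.Moschandreou2022.Step_vorticity21` — (21) p.4 l.422–427 «the vorticity in 3D,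
  ω⃗, is twice the angular velocity, ω⃗ = 2(r⃗ × u⃗)/|r⃗|²», typed as the identity `curl u(r) =
  2(r × u(r))/|r|²` for differentiable `u` and `r ≠ 0`. FALSE: (i) `u ≡ e₁` at `r = e₂`: curl `0`,
  right-hand side `−2e₃` (kit); (ii) even for the rigid rotation `u(r) = e₃ × r = (−y, x, 0)` — the one
  case where «vorticity = twice the angular velocity» is a theorem (`curl u = 2e₃`, `curl_rigid`) —
  the printed right-hand side is the ORBITAL angular velocity about the origin and vanishes on the
  rotation axis: at `r = e₃`, `2(r × u(r))/|r|² = 0 ≠ 2e₃` (refuter-2; kills the charitable reading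
  R#1 of the referee's menu).
* `Literature.Claims.NS.Moschandreou2022.Step_kappa21` — the substituted instance (21 bis)/(22) p.4
  l.428–434, the LOAD-BEARING one (it enters (18) and the `u_z` equation): `U_x = U_y = 0`, `u_z ≡ 1`,
  `r = e₂`: `ω₁ − ω₂ = 0` but the printed `κ = 2` (kit).
* `Literature.Claims.NS.Moschandreou2022.BlowupSolutionExists4` — the §4 object: its datum is not
  ℤ³-periodic when `η ≠ 0` (first component `0` at `r = 0`, `η` at `r = e₂`) (kit); hence
  `Step_inference4` holds vacuously and `Step_assembly4 M` FAILS for every Maple atom `M.ode28` that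
  holds, given the (true, displayed) calculus step `Step_logistic28` (`step_assembly4_false_of`).
* `Step_assembly M` holds VACUOUSLY for every `M` (its antecedent contains `Step_vorticity21`).

Not attacked (census): `Step_inference : NonSmoothSolutionExists → ClaimedTheorem` is, given the
landed `nonSmoothSolutionExists_holds` (a pressure-gauge exhibit, salvage-p5 g2), EQUIVALENT to the
claimed theorem `¬(B)` itself (`inference_iff_claim_of_exists`) — an unfilled gap / circular step, not a
kernel target. `ClaimedTheorem = ¬ clayPeriodic.Regularity` is the open problem and is not touched.

WHAT THIS IS NOT: not a claim about NS regularity or blow-up; not a claim about any author beyond the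
typed locator.
-/

set_option linter.dupNamespace false

open scoped Matrix

namespace Summit.NavierStokesRegularity.NavierStokesRegularity.Theorems.Moschandreou2022

open Literature.Claims.NS.Moschandreou2022
open Literature.Analysis.FluidPDE

noncomputable section

/-- `e₂ ≠ 0` in `ℝ³` (Lean index `1`). [folklore] -/
private theorem e1_ne_zero : (EuclideanSpace.single (1 : Fin 3) (1 : ℝ) : E3) ≠ 0 := by
  intro h0
  have := congrArg (fun v : E3 => v 1) h0
  simp at this

/-! ### (21) as printed: the constant field (typist-7 g2's kit) -/

/-- **Step 1 fails** ((21) p.4 l.422–427): constant field `u ≡ e₁`, point `r = e₂`; third components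
`0` vs `−2`. [cite: Moschandreou2022, eq. (21) p.4 l.422–427] -/
theorem not_Step_vorticity21 : ¬ Literature.Claims.NS.Moschandreou2022.Step_vorticity21 := by
  intro h
  have key := h (fun _ => EuclideanSpace.single (0 : Fin 3) (1 : ℝ)) (differentiable_const _)
    (EuclideanSpace.single (1 : Fin 3) (1 : ℝ)) e1_ne_zero
  have k2 := congrArg (fun v : E3 => v 2) key
  simp [curl, angularVorticity, cross, cross_apply] at k2

/-- **Step 1′ fails** ((21 bis)/(22) p.4 l.428–434, the substituted instance): `U_x = U_y = 0`,
`u_z ≡ 1`, `t = 0`, `r = e₂`: the curl side is `0`, the printed `κ` is `2`.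
[cite: Moschandreou2022, eq. (21 bis) p.4 l.428–434] -/
theorem not_Step_kappa21 : ¬ Literature.Claims.NS.Moschandreou2022.Step_kappa21 := by
  intro h
  have key := h (fun _ => (0 : ℝ)) (fun _ => (0 : ℝ)) (fun _ _ => (1 : ℝ)) (differentiable_const _)
    (differentiable_const _) (fun _ => differentiable_const _) 0
    (EuclideanSpace.single (1 : Fin 3) (1 : ℝ)) e1_ne_zero
  simp [curl, kappa21] at key

/-- **Step 5 is vacuous**: the antecedent of `Step_assembly M` contains `Step_vorticity21`, which is
false, so `Step_assembly M` holds for every `M` with no content. [cite: Moschandreou2022, p.4 l.481] -/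
theorem step_assembly_vacuous (M : MapleRun) : Step_assembly M :=
  fun h => absurd h.1 not_Step_vorticity21

/-! ### (21) under the charitable «rigid rotation» reading (refuter-2) -/

/-- The standard basis vector `e_j` (Lean indices `0, 1, 2`). [folklore] -/
def e (j : Fin 3) : E3 := EuclideanSpace.single j 1

/-- The coordinate functional `r ↦ r_i`. [folklore] -/
def P (i : Fin 3) : E3 →L[ℝ] ℝ := EuclideanSpace.proj i

/-- `P i r = r i`. [folklore] -/
@[simp] theorem P_apply (i : Fin 3) (r : E3) : P i r = r i := rfl

/-- The rigid rotation about the `z`-axis with unit angular velocity `Ω = e₃`: `u(r) = e₃ × r =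
(−y, x, 0)`, as a continuous linear map. [folklore] -/
def rigidL : E3 →L[ℝ] E3 := (P 0).smulRight (e 1) - (P 1).smulRight (e 0)

/-- `u(r) = x e₂ − y e₁` (Lean: `r 0 • e 1 − r 1 • e 0`). [folklore] -/
theorem rigidL_apply (r : E3) : rigidL r = (r 0) • e 1 - (r 1) • e 0 := by
  simp [rigidL]

/-- **The true content of «vorticity = twice the angular velocity»:** the rigid rotation `e₃ × r` has
`curl = 2e₃` everywhere. [folklore] -/
theorem curl_rigid (r : E3) : curl rigidL r = (2 : ℝ) • e 2 := by
  ext i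
  fin_cases i
  · simp only [curl, ContinuousLinearMap.fderiv]; simp [rigidL_apply, e]
  · simp only [curl, ContinuousLinearMap.fderiv]; simp [rigidL_apply, e]
  · simp only [curl, ContinuousLinearMap.fderiv]; simp [rigidL_apply, e]; norm_num

/-- **… while the printed right-hand side of (21) is the ORBITAL angular velocity about the origin and
vanishes on the rotation axis:** at `r = e₃`, `u(e₃) = 0`, so `2(r × u)/|r|² = 0`.
[cite: Moschandreou2022, eq. (21) p.4 l.422–427] -/
theorem angularVorticity_rigid_axis : angularVorticity rigidL (e 2) = 0 := by
  have h0 : rigidL (e 2) = 0 := by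
    rw [rigidL_apply]
    simp [e]
  simp [angularVorticity, h0, cross, cross_apply]

/-- (21) fails for the rigid rotation on its axis: `2e₃ ≠ 0`. [folklore] -/
theorem vorticity21_fails_for_rigid_rotation :
    curl rigidL (e 2) ≠ angularVorticity rigidL (e 2) := by
  rw [curl_rigid, angularVorticity_rigid_axis]
  intro h
  have := congrArg (fun v : E3 => v 2) h
  simp [e] at this

/-- **Second, independent proof of `¬ Step_vorticity21`** — the rigid rotation, i.e. the one field for
which the slogan is a theorem, already violates the printed formula. [cite: Moschandreou2022, eq. (21) p.4 l.422–427] -/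
theorem not_Step_vorticity21_rigid : ¬ Literature.Claims.NS.Moschandreou2022.Step_vorticity21 := by
  intro h
  have he : (e 2 : E3) ≠ 0 := by
    intro h0
    have := congrArg (fun v : E3 => v 2) h0
    simp [e] at this
  exact vorticity21_fails_for_rigid_rotation (h _ rigidL.differentiable (e 2) he)

/-! ### §4: the blow-up object (typist-7 g2's kit) and the assembly step (refuter-2) -/

/-- **The §4 blow-up object does not exist** ((24)–(25) p.5 l.489–501, «η → ∞»): the datum
`field4 n η Fx Fy g h k f 0` is not ℤ³-periodic when `η ≠ 0` (compare `r = 0` and `r = e₂`: first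
component `0` vs `η`). [cite: Moschandreou2022, §4 eqs. (24)–(25) p.5 l.489–501] -/
theorem not_BlowupSolutionExists4 : ¬ Literature.Claims.NS.Moschandreou2022.BlowupSolutionExists4 := by
  rintro ⟨n, η, Fx, Fy, g, h, k, A, A₁, A₂, C₁, ν, T, P, hη, _, _, _, _, _, hper, _⟩
  have h1 := congrArg (fun v : E3 => v 0) (hper 1 0)
  simp [field4] at h1
  exact hη h1

/-- **Step 10 is vacuous**: its antecedent `BlowupSolutionExists4` is false.
[cite: Moschandreou2022, §1 p.2 l.139; §4 p.5] -/
theorem step_inference4_vacuous : Step_inference4 :=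
  fun hb => absurd hb not_BlowupSolutionExists4

/-- **Step 9 fails whenever its antecedents hold**: for every Maple atom `M` whose `ode28` holds, and
given the displayed calculus `Step_logistic28` (true: (29) solves (28) and the denominator vanishes at
(30)), the assembly `Step_assembly4 M` would produce the non-existent §4 object.
[cite: Moschandreou2022, §4 p.5 l.484–521] -/
theorem step_assembly4_false_of (h28 : Step_logistic28) (M : MapleRun) (hM : M.ode28) :
    ¬ Step_assembly4 M :=
  fun h => not_BlowupSolutionExists4 (h ⟨h28, hM⟩)

end

end Summit.NavierStokesRegularity.NavierStokesRegularity.Theorems.Moschandreou2022
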